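import Summits.Ventures.Crystal3D.Theorems.StickyWulffConstantNoReconstructionGainFourFamilyLocal
import HarnessLib

/-!
# Four-family Barlow films: plugs never sit at a cost-0 slot (exclusion by the substrate)

HONEST FRAMING. Part of the venture `Summits/Ventures/Crystal3D` (cell `crystal3d-full`), helper
`--supports` the crux `NoReconstructionGain` (stmt-Ventures-19144, route
`route-Ventures-StickyWulffConstant`), line `adhesion`; continuation of `…FourFamilyLocal` (class (ii)).

The four-family certificate in the fundamental chamber gives cost `2` to the 18 directions of
`fourFamilyChamber_cliques` (`A18`) and cost `0` to their 18 antipodes (`−A18`, listed here).  A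
substrate ball ("plug") always costs `2`, so a plug `p = x + d` at a cost-0 direction `d ∈ −A18` of a
film ball `x` would break the count — but it cannot occur: for every `d ∈ −A18` there is a head
`e` (one of the six `ν`-nonpositive kissing vectors of the chamber) with `‖d + e‖ < 1`, and the substrate
is closed under `p ↦ p + e` at film-adjacent balls (slab sample, `slabForm_of_localClosure_level`), so
`p + e ∈ P` would be closer than `1` to `x`.  For the six kissing vectors of `−A18` the head is `−d`
itself (`p + e = x`); for the twelve cost-0 twins it is an endpoint of the twin's edge.

* `third_add_sq` — `‖(1/3)•pos L + pos l‖²` by one label;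
* `fourFamilyChamber_plugExclusion` — `∀ d ∈ −A18, ∃ e ∈ heads, ‖d + e‖ < 1`.

WHAT THIS IS NOT: the direction lemma and the assembly (next files); F-C1 not moved.
-/

noncomputable section

namespace Summit.Ventures.Crystal3D.Theorems

open Summit.Ventures.Crystal3D Finset
open Literature.MathematicalPhysics.StatisticalMechanics (barlowPos barlowOffset layerNormal constHagg
  haggLabel_const barlowPos_apply_zero barlowPos_apply_one barlowPos_apply_two)
open scoped InnerProductSpace

/-- `‖(1/3) • pos L + pos l‖²` via the label `L + 3 l`. -/
theorem third_add_sq (K I J k i j : ℤ) :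
    ‖(1 / 3 : ℝ) • barlowPos 1 (Real.sqrt (2 / 3)) constHagg K I J + barlowPos 1 (Real.sqrt (2 / 3)) constHagg k i j‖ ^ 2 =
      (1 / 9) * (((I + 3 * i : ℤ) : ℝ) + ((J + 3 * j : ℤ) : ℝ) / 2 + ((K + 3 * k : ℤ) : ℝ) / 2) ^ 2
        + (1 / 9) * (3 / 4 * (((J + 3 * j : ℤ) : ℝ) + ((K + 3 * k : ℤ) : ℝ) / 3) ^ 2)
        + (1 / 9) * (2 / 3 * (((K + 3 * k : ℤ) : ℝ)) ^ 2) := by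
  have e : (1 / 3 : ℝ) • barlowPos 1 (Real.sqrt (2 / 3)) constHagg K I J + barlowPos 1 (Real.sqrt (2 / 3)) constHagg k i j =
      (1 / 3 : ℝ) • barlowPos 1 (Real.sqrt (2 / 3)) constHagg (K + 3 * k) (I + 3 * i) (J + 3 * j) := by
    have := barlowPos_zlin 1 3 K I J k i j
    simp only [Int.cast_one, one_smul, Int.cast_ofNat, one_mul] at this
    rw [show (1 / 3 : ℝ) • barlowPos 1 (Real.sqrt (2 / 3)) constHagg K I J + barlowPos 1 (Real.sqrt (2 / 3)) constHagg k i j =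
        (1 / 3 : ℝ) • (barlowPos 1 (Real.sqrt (2 / 3)) constHagg K I J + (3 : ℝ) • barlowPos 1 (Real.sqrt (2 / 3)) constHagg k i j) by rw [smul_add, smul_smul]; norm_num, this]
  rw [e, norm_smul, mul_pow, barlowPos_normSq, show ‖(1 / 3 : ℝ)‖ = 1 / 3 by norm_num]
  push_cast
  ring

/-- **Plug exclusion table.**  For each of the 18 cost-0 directions `d` of the chamber certificate
(the antipodes of the directions of `fourFamilyChamber_cliques`) there is a head `e` with
`‖d + e‖ < 1`. -/
theorem fourFamilyChamber_plugExclusion :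
    ∀ d ∈ ([-barlowPos 1 (Real.sqrt (2 / 3)) constHagg 0 1 (-1),
      barlowPos 1 (Real.sqrt (2 / 3)) constHagg 1 0 0,
      barlowPos 1 (Real.sqrt (2 / 3)) constHagg 0 1 0,
      -barlowPos 1 (Real.sqrt (2 / 3)) constHagg (-1) 0 1,
      barlowPos 1 (Real.sqrt (2 / 3)) constHagg 0 0 1,
      -barlowPos 1 (Real.sqrt (2 / 3)) constHagg (-1) 1 0,
      (1 / 3 : ℝ) • barlowPos 1 (Real.sqrt (2 / 3)) constHagg 3 (-2) 1,
      (1 / 3 : ℝ) • barlowPos 1 (Real.sqrt (2 / 3)) constHagg 2 (-1) 2,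
      (1 / 3 : ℝ) • barlowPos 1 (Real.sqrt (2 / 3)) constHagg 2 (-3) 2,
      (1 / 3 : ℝ) • barlowPos 1 (Real.sqrt (2 / 3)) constHagg 1 (-2) 3,
      (1 / 3 : ℝ) • barlowPos 1 (Real.sqrt (2 / 3)) constHagg 3 1 (-2),
      (1 / 3 : ℝ) • barlowPos 1 (Real.sqrt (2 / 3)) constHagg 2 2 (-1),
      (1 / 3 : ℝ) • barlowPos 1 (Real.sqrt (2 / 3)) constHagg 2 2 (-3),
      (1 / 3 : ℝ) • barlowPos 1 (Real.sqrt (2 / 3)) constHagg 1 3 (-2),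
      (1 / 3 : ℝ) • barlowPos 1 (Real.sqrt (2 / 3)) constHagg 3 (-2) (-2),
      (1 / 3 : ℝ) • barlowPos 1 (Real.sqrt (2 / 3)) constHagg 2 (-3) (-1),
      (1 / 3 : ℝ) • barlowPos 1 (Real.sqrt (2 / 3)) constHagg (-1) 2 2,
      (1 / 3 : ℝ) • barlowPos 1 (Real.sqrt (2 / 3)) constHagg (-2) 1 3] : List (EuclideanSpace ℝ (Fin 3))),
      ∃ e ∈ ([barlowPos 1 (Real.sqrt (2 / 3)) constHagg 0 1 (-1), -barlowPos 1 (Real.sqrt (2 / 3)) constHagg 1 0 0, -barlowPos 1 (Real.sqrt (2 / 3)) constHagg 0 1 0,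
      barlowPos 1 (Real.sqrt (2 / 3)) constHagg (-1) 0 1, -barlowPos 1 (Real.sqrt (2 / 3)) constHagg 0 0 1, barlowPos 1 (Real.sqrt (2 / 3)) constHagg (-1) 1 0] : List (EuclideanSpace ℝ (Fin 3))), ‖d + e‖ < 1 := by
  have lt1 : ∀ x : EuclideanSpace ℝ (Fin 3), ‖x‖ ^ 2 < 1 → ‖x‖ < 1 := fun x h => by
    nlinarith [norm_nonneg x]
  intro d hd
  simp only [List.mem_cons, List.mem_nil_iff, or_false] at hd
  rcases hd with rfl | rfl | rfl | rfl | rfl | rfl | rfl | rfl | rfl | rfl | rfl | rfl | rfl | rfl | rfl |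
    rfl | rfl | rfl
  · exact ⟨barlowPos 1 (Real.sqrt (2 / 3)) constHagg 0 1 (-1), by simp, by rw [neg_add_cancel, norm_zero]; norm_num⟩
  · exact ⟨-barlowPos 1 (Real.sqrt (2 / 3)) constHagg 1 0 0, by simp, by rw [add_neg_cancel, norm_zero]; norm_num⟩
  · exact ⟨-barlowPos 1 (Real.sqrt (2 / 3)) constHagg 0 1 0, by simp, by rw [add_neg_cancel, norm_zero]; norm_num⟩
  · exact ⟨barlowPos 1 (Real.sqrt (2 / 3)) constHagg (-1) 0 1, by simp, by rw [neg_add_cancel, norm_zero]; norm_num⟩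
  · exact ⟨-barlowPos 1 (Real.sqrt (2 / 3)) constHagg 0 0 1, by simp, by rw [add_neg_cancel, norm_zero]; norm_num⟩
  · exact ⟨barlowPos 1 (Real.sqrt (2 / 3)) constHagg (-1) 1 0, by simp, by rw [neg_add_cancel, norm_zero]; norm_num⟩
  · exact ⟨-barlowPos 1 (Real.sqrt (2 / 3)) constHagg 1 0 0, by simp, lt1 _ (by rw [← sub_eq_add_neg, ← dist_eq_norm, third_dist_sq]; push_cast; norm_num)⟩
  · exact ⟨-barlowPos 1 (Real.sqrt (2 / 3)) constHagg 1 0 0, by simp, lt1 _ (by rw [← sub_eq_add_neg, ← dist_eq_norm, third_dist_sq]; push_cast; norm_num)⟩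
  · exact ⟨barlowPos 1 (Real.sqrt (2 / 3)) constHagg 0 1 (-1), by simp, lt1 _ (by rw [third_add_sq]; push_cast; norm_num)⟩
  · exact ⟨barlowPos 1 (Real.sqrt (2 / 3)) constHagg 0 1 (-1), by simp, lt1 _ (by rw [third_add_sq]; push_cast; norm_num)⟩
  · exact ⟨-barlowPos 1 (Real.sqrt (2 / 3)) constHagg 1 0 0, by simp, lt1 _ (by rw [← sub_eq_add_neg, ← dist_eq_norm, third_dist_sq]; push_cast; norm_num)⟩
  · exact ⟨-barlowPos 1 (Real.sqrt (2 / 3)) constHagg 1 0 0, by simp, lt1 _ (by rw [← sub_eq_add_neg, ← dist_eq_norm, third_dist_sq]; push_cast; norm_num)⟩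
  · exact ⟨barlowPos 1 (Real.sqrt (2 / 3)) constHagg (-1) 0 1, by simp, lt1 _ (by rw [third_add_sq]; push_cast; norm_num)⟩
  · exact ⟨-barlowPos 1 (Real.sqrt (2 / 3)) constHagg 0 1 0, by simp, lt1 _ (by rw [← sub_eq_add_neg, ← dist_eq_norm, third_dist_sq]; push_cast; norm_num)⟩
  · exact ⟨barlowPos 1 (Real.sqrt (2 / 3)) constHagg (-1) 1 0, by simp, lt1 _ (by rw [third_add_sq]; push_cast; norm_num)⟩
  · exact ⟨barlowPos 1 (Real.sqrt (2 / 3)) constHagg (-1) 1 0, by simp, lt1 _ (by rw [third_add_sq]; push_cast; norm_num)⟩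
  · exact ⟨-barlowPos 1 (Real.sqrt (2 / 3)) constHagg 0 0 1, by simp, lt1 _ (by rw [← sub_eq_add_neg, ← dist_eq_norm, third_dist_sq]; push_cast; norm_num)⟩
  · exact ⟨-barlowPos 1 (Real.sqrt (2 / 3)) constHagg 0 0 1, by simp, lt1 _ (by rw [← sub_eq_add_neg, ← dist_eq_norm, third_dist_sq]; push_cast; norm_num)⟩

end Summit.Ventures.Crystal3D.Theorems

end
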